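import Summits.CriticalPhenomena.PercolationContinuityZ3.Theorems.PercNearOneGluingAdditiveGluingFingerBridgeValues
import HarnessLib

/-! # Crux `PercNearOneGluing.AdditiveGluing` (stmt-CriticalPhenomena-4576) — pattern reliabilities of a finger block, ANY number of contact relays
# (seat (b) V⁺-form, depth prover `png-dp-vplus`)

Support file (`--supports stmt-CriticalPhenomena-4576`); no definitions, no named facts.  Generalises `…FingerBridgeValues.lean` /
`…FingerBridgeGlued.lean` (two contact relays) to an arbitrary finite set `F` of contact pairs `s(v,w)` (`v ∈ N`, `w ∉ N`) of a finger block `N`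
all of whose other non-loop pairs have weight `0` (fingers pairwise non-adjacent, no further contacts).  For a pattern `J ⊆ F` and `y, b ∉ N`,
with `q` = `K` with the pairs at `N` killed:
* `real_openConn_pinW_unglued_bridge`:  `μ_{pinW K F J}(y↔b) = μ_q{y↔b in (ω∖pairs at N) ∪ B_J}`, `B_J` = the BRIDGE pairs `s(w,w')` (some finger has
  both `s(v,w), s(v,w') ∈ J`);
* `real_openConn_pinW_glued_clique`:    `μ_{pinW (K/N) F J}(y↔b) = μ_q{y↔b in (ω∖pairs at N) ∪ C_J}`, `C_J` = ALL pairs between relays touched by `J`.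
These give the pattern expansions `μ_K(y↔b) = Σ_J cyl(J)·A_{B_J}(y)`, `μ_{K/N}(· ) = Σ_J cyl(J)·A_{C_J}(·)` behind the two-contact theorem, for any
number of contacts (the infrastructure a k-contact version of `fingerML3_twoContacts_core` needs).  [folklore; KozmaNitzan2024 §3.1, §4 p. 20]
-/

namespace Summit.CriticalPhenomena.PercolationContinuityZ3.Theorems

open MeasureTheory Set
open Literature.Probability.LatticeModels (prodBernoulli)
open Literature.Probability.Percolation (BondConfig openConn openGraph pinW localCylinder DeterminedBy determinedBy_iff)

noncomputable section
open Classical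

section FingerPatternValues

open Literature.Probability.LatticeModels Literature.Probability.Percolation

variable {n : ℕ}

/-- Condition (b) for a general pattern: two outside vertices joined by the contact pairs of `J` alone are joined by the BRIDGE pairs of `J`
(`s(w,w')` with `s(v,w), s(v,w') ∈ J` for one finger `v`). [folklore] -/
theorem detour_b_bridge (N : Finset (Fin n)) (J : Finset (Sym2 (Fin n)))
    (hJ : ∀ e ∈ J, ∃ v ∈ N, ∃ w ∉ N, e = s(v, w))
    (u u' : Fin n) (hu : u ∉ N) (hu' : u' ∉ N) (h : (openGraph (↑J : Set (Sym2 (Fin n)))).Reachable u u') :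
    (openGraph ({e : Sym2 (Fin n) | ∃ v ∈ N, ∃ w w' : Fin n, w ∉ N ∧ w' ∉ N ∧ w ≠ w' ∧ s(v, w) ∈ J ∧ s(v, w') ∈ J ∧ e = s(w, w')})).Reachable
      u u' := by
  set B : Set (Sym2 (Fin n)) :=
    {e | ∃ v ∈ N, ∃ w w' : Fin n, w ∉ N ∧ w' ∉ N ∧ w ≠ w' ∧ s(v, w) ∈ J ∧ s(v, w') ∈ J ∧ e = s(w, w')} with hB
  obtain ⟨p⟩ := h
  -- invariant along a `J`-walk from `u`
  let P : Fin n → Prop := fun z =>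
    (z ∉ N ∧ (openGraph B).Reachable u z) ∨ (z ∈ N ∧ ∃ w : Fin n, w ∉ N ∧ s(z, w) ∈ J ∧ (openGraph B).Reachable u w)
  suffices key : ∀ (x z : Fin n) (r : (openGraph (↑J : Set (Sym2 (Fin n)))).Walk x z), P x → P z by
    rcases key u u' p (Or.inl ⟨hu, SimpleGraph.Reachable.refl _⟩) with ⟨-, h⟩ | ⟨hN, -⟩
    · exact h
    · exact (hu' hN).elim
  intro x z r
  induction r with
  | nil => exact id
  | cons hadj r ih =>
    intro hx
    refine ih ?_
    rename_i x' z' _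
    obtain ⟨hmem, hne⟩ := (openGraph_adj _ x' z').1 hadj
    have hmemJ : s(x', z') ∈ J := Finset.mem_coe.1 hmem
    obtain ⟨v, hv, w, hw, he⟩ := hJ _ hmemJ
    rcases hx with ⟨hxN, hux⟩ | ⟨hxN, w₀, hw₀, hxw₀, huw₀⟩
    · -- `x' ∉ N`: `x' = w`, `z' = v ∈ N`, witnessed by `x'`
      rcases Sym2.eq_iff.1 he with ⟨h1, h2⟩ | ⟨h1, h2⟩
      · exact (hxN (h1 ▸ hv)).elim
      · right
        refine ⟨h2 ▸ hv, x', hxN, ?_, hux⟩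
        rw [Sym2.eq_swap]; exact hmemJ
    · -- `x' ∈ N` touching `w₀`: the step goes to `z' = w ∉ N`; bridge `s(w₀, z')` unless equal
      rcases Sym2.eq_iff.1 he with ⟨h1, h2⟩ | ⟨h1, h2⟩
      · subst h1; subst h2
        left
        refine ⟨hw, ?_⟩
        by_cases hwz : w₀ = z'
        · rw [← hwz]; exact huw₀
        · have hBmem : s(w₀, z') ∈ B := ⟨x', hxN, w₀, z', hw₀, hw, hwz, hxw₀, hmemJ, rfl⟩
          exact huw₀.trans ((openGraph_adj _ w₀ z').2 ⟨hBmem, hwz⟩).reachable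
      · exact (hw (h1 ▸ hxN)).elim

/-- Contact pairs never lie inside the block. -/
theorem contactPair_not_internal (N : Finset (Fin n)) (F : Finset (Sym2 (Fin n)))
    (hF : ∀ e ∈ F, ∃ v ∈ N, ∃ w ∉ N, e = s(v, w)) (e : Sym2 (Fin n)) (he : e ∈ F) : ¬ (∀ z ∈ e, z ∈ N) := by
  obtain ⟨v, -, w, hw, rfl⟩ := hF e he
  exact fun h => hw (h w (Sym2.mem_mk_right v w))

/-- **Un-glued pattern reliability, general contact set.**  Finger block `N`, contact pairs `F` (pairs `s(v,w)`, `v ∈ N`, `w ∉ N`), every other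
non-loop pair meeting `N` of weight `0`; pattern `J ⊆ F`; `y, b ∉ N`.  Then `μ_{pinW K F J}(y↔b) = μ_q{y ↔ b in (ω∖pairs at N) ∪ B_J}` with `B_J`
the bridge pairs of `J`. [folklore; KozmaNitzan2024 §4 p. 20] -/
theorem real_openConn_pinW_unglued_bridge (K : Sym2 (Fin n) → unitInterval) (N : Finset (Fin n)) (F J : Finset (Sym2 (Fin n)))
    (hF : ∀ e ∈ F, ∃ v ∈ N, ∃ w ∉ N, e = s(v, w)) (hJF : J ⊆ F)
    (hK0 : ∀ e : Sym2 (Fin n), e ∉ F → ¬ e.IsDiag → (∃ z ∈ e, z ∈ N) → K e = 0)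
    {y b : Fin n} (hy : y ∉ N) (hbN : b ∉ N) :
    (prodBernoulli (pinW K (↑F : Set (Sym2 (Fin n))) ↑J)).real (openConn y b) =
      (prodBernoulli (fun e : Sym2 (Fin n) => if (∃ z ∈ e, z ∈ N) then (0 : unitInterval) else K e)).real
        {ω : BondConfig (Fin n) | (openGraph (({e | e ∈ ω ∧ ∀ z ∈ e, z ∉ N} ∪
          {e : Sym2 (Fin n) | ∃ v ∈ N, ∃ w w' : Fin n, w ∉ N ∧ w' ∉ N ∧ w ≠ w' ∧ s(v, w) ∈ J ∧ s(v, w') ∈ J ∧ e = s(w, w')} :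
            Set (Sym2 (Fin n))) : BondConfig (Fin n))).Reachable y b} := by
  have hJ : ∀ e ∈ J, ∃ v ∈ N, ∃ w ∉ N, e = s(v, w) := fun e he => hF e (hJF he)
  refine real_openConn_eq_of_blockPairs_nd _ _ N J _ ?_ ?_ ?_ ?_ ?_ ?_ hy hbN
  · intro e he
    exact pinW_apply_of_mem_of_mem K (Finset.mem_coe.2 (hJF he)) (Finset.mem_coe.2 he)
  · intro e heJ hnd hz
    by_cases heF : e ∈ F
    · exact pinW_apply_of_mem_of_not_mem K (Finset.mem_coe.2 heF) (fun h => heJ (Finset.mem_coe.1 h))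
    · rw [pinW_apply_of_not_mem K _ (fun h => heF (Finset.mem_coe.1 h))]
      exact hK0 e heF hnd hz
  · rintro e ⟨v, hv, w, w', hw, hw', hne, h1, h2, rfl⟩ z hz
    rcases Sym2.mem_iff.1 hz with rfl | rfl
    · exact hw
    · exact hw'
  · rintro e ⟨v, hv, w, w', hw, hw', hne, h1, h2, rfl⟩ u hu u' hu'
    have hreach : ∀ x ∈ s(w, w'), (openGraph (↑J : Set (Sym2 (Fin n)))).Reachable v x := by
      intro x hx
      rcases Sym2.mem_iff.1 hx with rfl | rfl
      · exact ((openGraph_adj _ v x).2 ⟨Finset.mem_coe.2 h1, fun h => hw (h ▸ hv)⟩).reachable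
      · exact ((openGraph_adj _ v x).2 ⟨Finset.mem_coe.2 h2, fun h => hw' (h ▸ hv)⟩).reachable
    exact (hreach u hu).symm.trans (hreach u' hu')
  · intro u u' hu hu' h
    exact detour_b_bridge N J hJ u u' hu hu' h
  · intro e he
    have heF : e ∉ (↑F : Set (Sym2 (Fin n))) := by
      intro heF
      obtain ⟨v, hv, w, -, rfl⟩ := hF e (Finset.mem_coe.1 heF)
      exact he v (Sym2.mem_mk_left v w) hv
    rw [pinW_apply_of_not_mem K _ heF]
    have : ¬ (∃ z ∈ e, z ∈ N) := fun ⟨z, hz, hzN⟩ => he z hz hzN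
    simp only [this, if_false]

/-- **Glued pattern reliability, general contact set.**  As `real_openConn_pinW_unglued_bridge` for `K/N` (block glued): for `y, b ∉ N`,
`μ_{pinW (K/N) F J}(y↔b) = μ_q{y ↔ b in (ω∖pairs at N) ∪ C_J}`, `C_J` = all pairs between distinct relays touched by `J`.
[folklore; KozmaNitzan2024 §3.1, §4 p. 20] -/
theorem real_openConn_pinW_glued_clique (K : Sym2 (Fin n) → unitInterval) (N : Finset (Fin n)) (F J : Finset (Sym2 (Fin n)))
    (hF : ∀ e ∈ F, ∃ v ∈ N, ∃ w ∉ N, e = s(v, w)) (hJF : J ⊆ F)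
    (hK0 : ∀ e : Sym2 (Fin n), e ∉ F → ¬ e.IsDiag → (∃ z ∈ e, z ∈ N) → ¬ (∀ z ∈ e, z ∈ N) → K e = 0)
    {y b : Fin n} (hy : y ∉ N) (hbN : b ∉ N) :
    (prodBernoulli (pinW (fun e' : Sym2 (Fin n) => if (∀ z ∈ e', z ∈ N) ∧ ¬ e'.IsDiag then 1 else K e')
        (↑F : Set (Sym2 (Fin n))) ↑J)).real (openConn y b) =
      (prodBernoulli (fun e : Sym2 (Fin n) => if (∃ z ∈ e, z ∈ N) then (0 : unitInterval) else K e)).real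
        {ω : BondConfig (Fin n) | (openGraph (({e | e ∈ ω ∧ ∀ z ∈ e, z ∉ N} ∪
          {e : Sym2 (Fin n) | ∃ w w' : Fin n, w ∉ N ∧ w' ∉ N ∧ w ≠ w' ∧ (∃ v ∈ N, s(v, w) ∈ J) ∧ (∃ v ∈ N, s(v, w') ∈ J) ∧
            e = s(w, w')} : Set (Sym2 (Fin n))) : BondConfig (Fin n))).Reachable y b} := by
  set g : Sym2 (Fin n) → unitInterval := fun e' => if (∀ z ∈ e', z ∈ N) ∧ ¬ e'.IsDiag then 1 else K e' with hg
  set I : Finset (Sym2 (Fin n)) := ((N ×ˢ N).filter (fun vv : Fin n × Fin n => vv.1 ≠ vv.2)).image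
    (fun vv => s(vv.1, vv.2)) with hI
  have hJ : ∀ e ∈ J, ∃ v ∈ N, ∃ w ∉ N, e = s(v, w) := fun e he => hF e (hJF he)
  have hIin : ∀ e ∈ I, (∀ z ∈ e, z ∈ N) ∧ ¬ e.IsDiag := by
    intro e he
    obtain ⟨⟨v, v'⟩, hvv, rfl⟩ := Finset.mem_image.1 he
    obtain ⟨hvv', hne⟩ := Finset.mem_filter.1 hvv
    obtain ⟨hv, hv'⟩ := Finset.mem_product.1 hvv'
    refine ⟨fun z hz => ?_, fun h => hne (Sym2.mk_isDiag_iff.1 h)⟩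
    rcases Sym2.mem_iff.1 hz with rfl | rfl
    · exact hv
    · exact hv'
  have hInotF : ∀ e ∈ I, e ∉ (↑F : Set (Sym2 (Fin n))) :=
    fun e he heF => contactPair_not_internal N F hF e (Finset.mem_coe.1 heF) (hIin e he).1
  have hImem : ∀ v ∈ N, ∀ v' ∈ N, v ≠ v' → s(v, v') ∈ I := fun v hv v' hv' hne =>
    Finset.mem_image.2 ⟨(v, v'), Finset.mem_filter.2 ⟨Finset.mem_product.2 ⟨hv, hv'⟩, hne⟩, rfl⟩
  refine real_openConn_eq_of_blockPairs_nd _ _ N (J ∪ I) _ ?_ ?_ ?_ ?_ ?_ ?_ hy hbN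
  · intro e he
    rcases Finset.mem_union.1 he with heJ | heI
    · exact pinW_apply_of_mem_of_mem g (Finset.mem_coe.2 (hJF heJ)) (Finset.mem_coe.2 heJ)
    · rw [pinW_apply_of_not_mem g _ (hInotF e heI)]
      show (if (∀ z ∈ e, z ∈ N) ∧ ¬ e.IsDiag then (1 : unitInterval) else K e) = 1
      rw [if_pos (hIin e heI)]
  · intro e heO hnd hz
    by_cases heF : e ∈ F
    · exact pinW_apply_of_mem_of_not_mem g (Finset.mem_coe.2 heF)
        (fun h => heO (Finset.mem_union.2 (Or.inl (Finset.mem_coe.1 h))))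
    · rw [pinW_apply_of_not_mem g _ (fun h => heF (Finset.mem_coe.1 h))]
      have hnotin : ¬ ((∀ z ∈ e, z ∈ N) ∧ ¬ e.IsDiag) := by
        rintro ⟨hin, -⟩
        apply heO (Finset.mem_union.2 (Or.inr ?_))
        induction e using Sym2.ind with
        | h x x' =>
          exact hImem x (hin x (Sym2.mem_mk_left x x')) x' (hin x' (Sym2.mem_mk_right x x')) fun h => hnd (Sym2.mk_isDiag_iff.2 h)
      simp only [hg, hnotin, if_false]
      exact hK0 e heF hnd hz (fun hin => hnotin ⟨hin, hnd⟩)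
  · rintro e ⟨w, w', hw, hw', hne, -, -, rfl⟩ z hz
    rcases Sym2.mem_iff.1 hz with rfl | rfl
    · exact hw
    · exact hw'
  · rintro e ⟨w, w', hw, hw', hne, ⟨v, hv, hvJ⟩, ⟨v', hv', hv'J⟩, rfl⟩ u hu u' hu'
    have hvv : (openGraph (↑(J ∪ I) : Set (Sym2 (Fin n)))).Reachable v v' := by
      by_cases h : v = v'
      · rw [h]
      · exact ((openGraph_adj _ v v').2 ⟨Finset.mem_coe.2 (Finset.mem_union.2 (Or.inr (hImem v hv v' hv' h))), h⟩).reachable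
    have hreach : ∀ x ∈ s(w, w'), (openGraph (↑(J ∪ I) : Set (Sym2 (Fin n)))).Reachable v x := by
      intro x hx
      rcases Sym2.mem_iff.1 hx with rfl | rfl
      · exact ((openGraph_adj _ v x).2 ⟨Finset.mem_coe.2 (Finset.mem_union.2 (Or.inl hvJ)), fun h => hw (h ▸ hv)⟩).reachable
      · exact hvv.trans ((openGraph_adj _ v' x).2 ⟨Finset.mem_coe.2 (Finset.mem_union.2 (Or.inl hv'J)),
          fun h => hw' (h ▸ hv')⟩).reachable
    exact (hreach u hu).symm.trans (hreach u' hu')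
  · intro u u' hu hu' h
    have hO : ∀ e ∈ (↑(J ∪ I) : Set (Sym2 (Fin n))),
        (e ∈ J ∧ ∃ v ∈ N, ∃ w ∈ (Finset.univ.filter fun w : Fin n => w ∉ N), e = s(v, w)) ∨ (∀ z ∈ e, z ∈ N) := by
      intro e he
      rcases Finset.mem_union.1 (Finset.mem_coe.1 he) with heJ | heI
      · obtain ⟨v, hv, w, hw, rfl⟩ := hJ e heJ
        exact Or.inl ⟨heJ, v, hv, w, Finset.mem_filter.2 ⟨Finset.mem_univ _, hw⟩, rfl⟩
      · exact Or.inr (hIin e heI).1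
    rcases detour_b_touched N (Finset.univ.filter fun w : Fin n => w ∉ N) J _ hO u u' hu hu' h with
      rfl | ⟨⟨-, hut⟩, ⟨-, hu't⟩⟩
    · exact SimpleGraph.Reachable.refl _
    · by_cases huu : u = u'
      · rw [huu]
      · have hCmem : s(u, u') ∈ ({e : Sym2 (Fin n) | ∃ w w' : Fin n, w ∉ N ∧ w' ∉ N ∧ w ≠ w' ∧ (∃ v ∈ N, s(v, w) ∈ J) ∧
            (∃ v ∈ N, s(v, w') ∈ J) ∧ e = s(w, w')} : Set (Sym2 (Fin n))) := ⟨u, u', hu, hu', huu, hut, hu't, rfl⟩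
        exact ((openGraph_adj _ u u').2 ⟨hCmem, huu⟩).reachable
  · intro e he
    have heF : e ∉ (↑F : Set (Sym2 (Fin n))) := by
      intro heF
      obtain ⟨v, hv, w, -, rfl⟩ := hF e (Finset.mem_coe.1 heF)
      exact he v (Sym2.mem_mk_left v w) hv
    rw [pinW_apply_of_not_mem g _ heF]
    have h1 : ¬ ((∀ z ∈ e, z ∈ N) ∧ ¬ e.IsDiag) := by
      induction e using Sym2.ind with
      | h x x' => exact fun h => he x (Sym2.mem_mk_left x x') (h.1 x (Sym2.mem_mk_left x x'))
    have h2 : ¬ (∃ z ∈ e, z ∈ N) := fun ⟨z, hz, hzN⟩ => he z hz hzN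
    simp only [hg, h1, h2, if_false]

end FingerPatternValues

end

end Summit.CriticalPhenomena.PercolationContinuityZ3.Theorems
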